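import Mathlib
import Literature.Computability.Complexity.CircuitClasses
import Literature.Computability.Complexity.ConstantDepth
import Literature.Computability.Complexity.CircuitLowerBounds
import Literature.Computability.Complexity.Promise
import Literature.Computability.MetaComplexity.MCSP
import Literature.Computability.MetaComplexity.FormulaModelsAE
import Literature.Computability.MetaComplexity.XorBottomModelsAE
import Literature.Computability.MetaComplexity.MagnificationFrontiersAE
import Literature.Computability.MetaComplexity.OliveiraPichSanthanam2019.GapMKtPMagnification
import HarnessLib

/-!
# CHOPRS, HM Frontiers B and C: Theorem 24 and item B1 (`MCSP[2^{n^{1/3}}, 2^{n^{2/3}}]` versus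
# `Formula-XOR[N^{1+ε}]`), item C1 (`MCSP[2^{√n}/10n, 2^{√n}]` versus `N^{0.01}`-almost-formulas) —
# the magnification THRESHOLDS (T) as named facts (census rows R6 and R7, MODEL-MISMATCH rows)

Source: L. Chen, S. Hirahara, I. C. Oliveira, J. Pich, N. Rajgopal, R. Santhanam, *Beyond natural
proofs: hardness magnification and locality*, arXiv:1911.08297 (ITCS 2020 / J. ACM 69(4) 2022) (bib
key `arXiv191108297`), §1.1 "HM Frontier B/C" (pp. 3–4), §3.2.1 Theorem 24 (p. 15), §3.3 Theorem 29
and the remark after it (pp. 16–18), §5.1.2 Proposition 43 and §5.2 Theorem 46 (locality, pp. 23–25).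
The KNOWN sides of both rows (items B4, C4: De Morgan formulas of leaf-size `N^{1.99}`) are the
tree's `chop_frontierB4_ae`, `chop_frontierC4_ae` (`MagnificationFrontiersAE`).

## The printed statements (verbatim; `\NC` is the source's macro for `NC¹`)

* §1.1 (p. 3): *"B1. If MCSP[2^{n^{1/3}}, 2^{n^{2/3}}] ∉ Formula-XOR[N^{1.01}] then NQP ⊄ NC¹."*
  *"B4. MCSP[2^{n^{1/3}}, 2^{n^{2/3}}] ∉ Formula[N^{1.99}]."* (p. 4): *"C1. MCSP[2^{n^{1/2}}/10n,
  2^{n^{1/2}}] ∉ N^{0.01}-Almost-Formula[N^{1.01}] implies NP ⊄ NC¹ (Section 3.3)."* *"C3. PARITY ∉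
  N^{0.01}-Almost-Formula[N^{1.01}]."* *"C4. MCSP[2^{n^{1/2}}/10n, 2^{n^{1/2}}] ∉ Formula[N^{1.99}]."*
* Notes B, C (p. 4): *"Formula-XOR[s] refers to the class of Boolean formulas over the De Morgan basis
  with at most s leaves, where each leaf is an XOR of arbitrary arity over the inputs [footnote: Note
  that Formula-XOR[N^{1.01}] ⊆ Formula[N^{3.01}]. …], and MCSP[s,t] denotes a promise problem over
  N = 2^n input bits with YES inputs being truth-tables of Boolean functions on n inputs which are
  computable by circuits of size s, and NO instances being truth-tables of Boolean functions which are
  hard for circuits of size t."* *"a γ-Almost-Formula[s] is a circuit containing at most s AND, OR,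
  NOT gates of fan-in at most 2, and among such gates, at most γ of them have fan-out larger than 1."*
* **Theorem 24** (p. 15). *"Assume that MCSP[2^{n^{1/3}}, 2^{n^{2/3}}] ∉ Formula-XOR[N^{1+ε}] for
  some constant ε > 0. Then either QP ⊄ P/poly or NP ⊄ NC¹. In particular, NQP ⊄ NC¹."*
* **Theorem 29** (p. 18, abridged). *"Assume that MCSP[2^{n^{1/2}}/2n, 2^{n^{1/2}}] is hard for
  circuits C (with 2^n inputs) of size 2^{n+O(n^{1/2})} with the following form [anticheckers
  y₁, …, f(y₁), … generated by subcircuits whose only gates with fanout > 1 are the previous yᵢ, f(yᵢ);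
  a formula of size 2^{O(n^{1/2})} on top]. Then NP ⊄ NC¹."* Remark (p. 18): *"Note that circuits
  from the assumption of hardness magnification via anticheckers, Theorem 29, are
  2^{O(n^{1/2})}-almost formulas of almost linear size which gives us C1."*

## Census value (rows R6, R7)

* R6 (Frontier B). T = B1/Thm 24: `Formula-XOR[N^{1.01}]` (XOR leaves); K = B4: De Morgan
  `Formula[N^{1.99}]` (after Hirahara–Santhanam 2017) — same promise problem, same length `N = 2ⁿ`,
  DIFFERENT models (`Formula[s] ⊊ Formula-XOR[s]`), so no numeric gap is printed between them:
  MODEL-MISMATCH. Derived same-model reading (not a printed magnification theorem): by the footnote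
  `Formula-XOR[N^{1.01}] ⊆ Formula[N^{3.01}]`, the De Morgan bound `MCSP[2^{n^{1/3}}, 2^{n^{2/3}}] ∉
  Formula[N^{3.01}]` would suffice; in the De Morgan leaf model the distance is the exponent `1.99`
  (known) versus `3.01` (sufficient). In the T model the explicit-function record is B3
  (`InnerProduct ∉ Formula-XOR[N^{1.99}]`, Tal 2017) — context, not a bound for `MCSP` (census rule
  F10). Locality barrier covering the row: Prop. 43 (B1^𝒪: *"For any ε > 0, MCSP[2^{n^{1/3}},
  2^{n^{2/3}}] ∈ Formula-𝒪-XOR[N^{1.01}], where every oracle 𝒪 has fan-in at most N^ε and appears in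
  the layer right above the XOR leaves"*; B3^𝒪: the three `Formula-XOR` techniques localize).
* R7 (Frontier C). T = C1: `N^{0.01}`-almost-formulas with `N^{1.01}` GATES; K = C4: De Morgan
  formulas with `N^{1.99}` LEAVES — different models and different size measures (a formula is a
  `0`-almost-formula, but an almost-formula with `N^{0.01}` gates of large fan-out does not unfold to a
  polynomial-size formula): MODEL-MISMATCH, no same-model reading available in print. Explicit-function
  record in the T model: C3/Thm 30 (`PARITY ∉ n^ε-almost-Formula[n^{2−9ε}]`) — context (F10).
  Locality barrier: Thm 46 (C1^𝒪, C3^𝒪).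

## Rendering (T side: our hypothesis implies the printed one — our class ⊇ print's, our promise
## problem ⊆ print's — and our conclusion is implied by the printed one)

* `MCSP[s, t]` ↦ `gapMCSP (⌊s⌋₊) (⌊t⌋₊)` of `MCSP.lean` (YES: `B₂`-circuit size `≤ s(n)`, NO: `> t(n)`,
  `n` the number of variables). Circuit sizes are integers, so BOTH floors are exact (`k ≤ s ↔ k ≤
  ⌊s⌋₊`, `k > t ↔ k > ⌊t⌋₊`): the typed problem IS the printed one. (The K facts `chop_frontierB4_ae`
  / `C4_ae` round the YES threshold UP, `⌈·⌉₊`, i.e. speak about a problem with MORE YES instances —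
  a consequence of the printed K bound; `gapMCSP_frontierB_yes_subset` relates the two.)
* `Formula-XOR[N^{1+ε}]` ↦ `FORMULAXORae (powSize (1 + ε))`, `N^{0.01}-Almost-Formula[N^{1.01}]` ↦
  `AlmostFORMULAae (powSize 0.01) (powSize 1.01)` (`XorBottomModelsAE`; `powSize κ N = ⌊N^κ⌋₊`; the
  printed classes are contained in these a.e. classes — module docstring there; over an a.e. class
  the finitely many small lengths where `⌊·⌋` conventions could matter are immaterial,
  `OliveiraPichSanthanam2019.not_mem_promiseLift_iff_forall_tailFrom`).
* Conclusions: Theorem 24's *"either QP ⊄ P/poly or NP ⊄ NC¹"* is NOT rendered (the tree has no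
  deterministic quasi-polynomial time class); its printed corollary *"NQP ⊄ NC¹"* (= B1's conclusion)
  is, as `¬ (NQP ⊆ NC1)` with the tree's `NQP = ⋃ₖ NTIME[2^{(log n)^k}]` and non-uniform `NC1` (⊆ the
  textbook class; the proofs use `NP ⊆ NC¹` only through polynomial-size formulas). C1: `¬ (NP ⊆ NC1)`.
* C1 is recorded as printed in §1.1 (its proof in print is Theorem 29 plus the quoted remark:
  C1's promise problem has FEWER YES instances than Theorem 29's — `2^{√n}/10n ≤ 2^{√n}/2n` — so its
  hardness implies the hardness Theorem 29 assumes, and the structured circuits of Theorem 29 are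
  `2^{O(√n)} ≤ N^{0.01}`-almost-formulas of size `2^{n+O(√n)} ≤ N^{1.01}` for large `n`). Theorem 29's
  bespoke circuit class is not typed.
* NON-VACUITY (F1): `headLang ∈ FORMULAXORae (powSize κ)` for `κ > 0` and `headLang ∈ AlmostFORMULAae
  γ s` (`XorBottomModelsAE`); so the hypotheses are not about empty classes.
* HONEST FRAMING: these are THRESHOLD facts; `FrontierB1Hypothesis`, `FrontierC1Hypothesis` are the
  OPEN lower bounds; nothing here is an approach to the summit.
-/

noncomputable section

namespace Literature.Computability.MetaComplexity

open Filter Topology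
open Literature.Computability.Complexity Literature.Computability.Complexity.Nondeterministic
open Literature.Computability.MetaComplexity.OliveiraPichSanthanam2019

/-! ### Thresholds and promise problems -/

/-- YES threshold `⌊2^{n^{1/3}}⌋₊` of Frontier B. [cite: arXiv191108297, §1.1 (B1, thresholds)] -/
def frontierBYes (n : ℕ) : ℕ := ⌊(2 : ℝ) ^ ((n : ℝ) ^ (1 / 3 : ℝ))⌋₊

/-- NO threshold `⌊2^{n^{2/3}}⌋₊` of Frontier B. [cite: arXiv191108297, §1.1 (B1, thresholds)] -/
def frontierBNo (n : ℕ) : ℕ := ⌊(2 : ℝ) ^ ((n : ℝ) ^ (2 / 3 : ℝ))⌋₊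

/-- YES threshold `⌊2^{√n}/10n⌋₊` of Frontier C. [cite: arXiv191108297, §1.1 (C1, thresholds)] -/
def frontierCYes (n : ℕ) : ℕ := ⌊(2 : ℝ) ^ Real.sqrt n / (10 * n)⌋₊

/-- NO threshold `⌊2^{√n}⌋₊` of Frontier C. [cite: arXiv191108297, §1.1 (C1, thresholds)] -/
def frontierCNo (n : ℕ) : ℕ := ⌊(2 : ℝ) ^ Real.sqrt n⌋₊

/-- `MCSP[2^{n^{1/3}}, 2^{n^{2/3}}]`. [cite: arXiv191108297, §1.1 (HM Frontier B)] -/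
def gapMCSPFrontierB : PromiseProblem := gapMCSP frontierBYes frontierBNo

/-- `MCSP[2^{√n}/10n, 2^{√n}]`. [cite: arXiv191108297, §1.1 (HM Frontier C)] -/
def gapMCSPFrontierC : PromiseProblem := gapMCSP frontierCYes frontierCNo

/-- `⌊2^{n^{1/3}}⌋ ≤ ⌊2^{n^{2/3}}⌋`. [folklore] -/
theorem frontierBYes_le_frontierBNo (n : ℕ) : frontierBYes n ≤ frontierBNo n := by
  unfold frontierBYes frontierBNo
  apply Nat.floor_le_floor
  rcases Nat.eq_zero_or_pos n with rfl | hn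
  · norm_num
  · have h1 : (1 : ℝ) ≤ n := by exact_mod_cast hn
    exact Real.rpow_le_rpow_of_exponent_le one_le_two
      (Real.rpow_le_rpow_of_exponent_le h1 (by norm_num))

/-- `⌊2^{√n}/10n⌋ ≤ ⌊2^{√n}⌋`. [folklore] -/
theorem frontierCYes_le_frontierCNo (n : ℕ) : frontierCYes n ≤ frontierCNo n := by
  unfold frontierCYes frontierCNo
  apply Nat.floor_le_floor
  have hpos : (0 : ℝ) < (2 : ℝ) ^ Real.sqrt n := by positivity
  rcases Nat.eq_zero_or_pos n with rfl | hn
  · simp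
  · have h10 : (1 : ℝ) ≤ 10 * n := by
      have : (1 : ℝ) ≤ n := by exact_mod_cast hn
      linarith
    exact div_le_self hpos.le h10

/-- The Frontier B problem is a promise problem (disjoint sides). [folklore] -/
theorem gapMCSPFrontierB_disjoint : gapMCSPFrontierB.Disjoint :=
  gapMCSP_disjoint frontierBYes_le_frontierBNo

/-- The Frontier C problem is a promise problem (disjoint sides). [folklore] -/
theorem gapMCSPFrontierC_disjoint : gapMCSPFrontierC.Disjoint :=
  gapMCSP_disjoint frontierCYes_le_frontierCNo

/-- The typed (= printed, exact floors) Frontier B problem has its YES side inside the YES side of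
the `⌈·⌉`-rounded problem of the K fact `chop_frontierB4_ae`, and the same NO side. [folklore] -/
theorem gapMCSP_frontierB_yes_subset :
    (∀ w, w ∈ gapMCSPFrontierB.yes → w ∈ (gapMCSP (fun n => ⌈(2 : ℝ) ^ ((n : ℝ) ^ (1 / 3 : ℝ))⌉₊)
      (fun n => ⌊(2 : ℝ) ^ ((n : ℝ) ^ (2 / 3 : ℝ))⌋₊)).yes) ∧
    gapMCSPFrontierB.no = (gapMCSP (fun n => ⌈(2 : ℝ) ^ ((n : ℝ) ^ (1 / 3 : ℝ))⌉₊)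
      (fun n => ⌊(2 : ℝ) ^ ((n : ℝ) ^ (2 / 3 : ℝ))⌋₊)).no := by
  refine ⟨?_, rfl⟩
  rintro w ⟨n, f, rfl, hf⟩
  exact ⟨n, f, rfl, hf.trans (Nat.floor_le_ceil _)⟩

/-! ### Statements -/

/-- **`MCSP[2^{n^{1/3}}, 2^{n^{2/3}}] ∉ Formula-XOR[N^{1+ε}]`** (the hypothesis of Theorem 24 at `ε`;
B1 is `ε = 0.01`): no language of `FORMULAXORae ⌊N^{1+ε}⌋` separates YES from NO. OPEN; recorded,
not asserted. [cite: arXiv191108297, Thm. 24 (hypothesis)] -/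
def MCSPFormulaXorLB (ε : ℝ) : Prop :=
  gapMCSPFrontierB ∉ promiseLift (FORMULAXORae (powSize (1 + ε)))

/-- **The hypothesis of B1** (census gap R6, T side): `MCSP[2^{n^{1/3}}, 2^{n^{2/3}}] ∉
Formula-XOR[N^{1.01}]`. OPEN; recorded, not asserted. [cite: arXiv191108297, §1.1 (B1, hypothesis)] -/
def FrontierB1Hypothesis : Prop :=
  gapMCSPFrontierB ∉ promiseLift (FORMULAXORae (powSize 1.01))

/-- **The hypothesis of C1** (census gap R7, T side): `MCSP[2^{√n}/10n, 2^{√n}] ∉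
N^{0.01}-Almost-Formula[N^{1.01}]`. OPEN; recorded, not asserted.
[cite: arXiv191108297, §1.1 (C1, hypothesis)] -/
def FrontierC1Hypothesis : Prop :=
  gapMCSPFrontierC ∉ promiseLift (AlmostFORMULAae (powSize 0.01) (powSize 1.01))

/-- NAMED FACT (**CHOPRS Theorem 24**, magnification for worst-case `MCSP` via error-correcting
codes; printed corollary form): *"Assume that MCSP[2^{n^{1/3}}, 2^{n^{2/3}}] ∉ Formula-XOR[N^{1+ε}]
for some constant ε > 0. Then either QP ⊄ P/poly or NP ⊄ NC¹. In particular, NQP ⊄ NC¹."* (only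
the "in particular" is rendered, module docstring). Users take `(h : chop_thm24)`.
[cite: arXiv191108297, Thm. 24] -/
def chop_thm24 : Prop :=
  (∃ ε : ℝ, 0 < ε ∧ MCSPFormulaXorLB ε) → ¬ (NQP ⊆ NC1)

/-- NAMED FACT (**CHOPRS §1.1, HM Frontier B, item B1**; proof: Theorem 24 with `ε = 0.01`,
`chop_frontierB1_of_thm24`): *"If MCSP[2^{n^{1/3}}, 2^{n^{2/3}}] ∉ Formula-XOR[N^{1.01}] then
NQP ⊄ NC¹."* Users take `(h : chop_frontierB1)`. [cite: arXiv191108297, §1.1 (B1)] -/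
def chop_frontierB1 : Prop :=
  FrontierB1Hypothesis → ¬ (NQP ⊆ NC1)

/-- NAMED FACT (**CHOPRS §1.1, HM Frontier C, item C1**; proof in print: Theorem 29 and the remark
after it, §3.3): *"MCSP[2^{n^{1/2}}/10n, 2^{n^{1/2}}] ∉ N^{0.01}-Almost-Formula[N^{1.01}] implies
NP ⊄ NC¹."* Users take `(h : chop_frontierC1)`. [cite: arXiv191108297, §1.1 (C1)] -/
def chop_frontierC1 : Prop :=
  FrontierC1Hypothesis → ¬ (NP ⊆ NC1)

/-! ### API -/

/-- B1 is Theorem 24 at `ε = 0.01`. [folklore] -/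
theorem chop_frontierB1_of_thm24 (h : chop_thm24) : chop_frontierB1 := by
  intro hB
  refine h ⟨0.01, by norm_num, ?_⟩
  have : (1 : ℝ) + 0.01 = 1.01 := by norm_num
  unfold MCSPFormulaXorLB
  rw [this]
  exact hB

/-- Theorem 24's hypothesis is monotone in `ε`: a lower bound against `Formula-XOR[N^{1+ε'}]`
gives one against `Formula-XOR[N^{1+ε}]` for `ε ≤ ε'`. [folklore] -/
theorem MCSPFormulaXorLB.anti {ε ε' : ℝ} (hle : ε ≤ ε') (h : MCSPFormulaXorLB ε') :
    MCSPFormulaXorLB ε := fun hmem =>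
  h (promiseLift_mono (FORMULAXORae_mono ⟨1, fun N hN =>
    Nat.floor_le_floor (Real.rpow_le_rpow_of_exponent_le (by exact_mod_cast hN) (by linarith))⟩)
    hmem)

/-- Consequence shape of Theorem 24. [cite: arXiv191108297, Thm. 24] -/
theorem not_NQP_subset_NC1_of_formulaXorLB (h : chop_thm24) {ε : ℝ} (hε : 0 < ε)
    (hLB : MCSPFormulaXorLB ε) : ¬ (NQP ⊆ NC1) :=
  h ⟨ε, hε, hLB⟩

/-- Consequence shape of C1. [cite: arXiv191108297, §1.1 (C1)] -/
theorem not_NP_subset_NC1_of_frontierC1Hypothesis (h : chop_frontierC1)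
    (hLB : FrontierC1Hypothesis) : ¬ (NP ⊆ NC1) :=
  h hLB

/-- `1 ≤ ⌊N^κ⌋₊` for `N ≥ 1`, `κ ≥ 0`. [folklore] -/
theorem one_le_powSize {κ : ℝ} (hκ : 0 ≤ κ) {N : ℕ} (hN : 1 ≤ N) : 1 ≤ powSize κ N := by
  unfold powSize
  rw [Nat.one_le_floor_iff]
  exact Real.one_le_rpow (by exact_mod_cast hN) hκ

/-- NON-VACUITY: the Formula-XOR class of Theorem 24 / B1 is inhabited for `1 + ε ≥ 0`
(`headLang`). [folklore] -/
theorem headLang_mem_FORMULAXORae_powSize {κ : ℝ} (hκ : 0 ≤ κ) :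
    headLang ∈ FORMULAXORae (powSize κ) :=
  headLang_mem_FORMULAXORae ⟨1, fun _ hN => one_le_powSize hκ hN⟩

/-- Hence `promiseLift (FORMULAXORae ⌊N^{1+ε}⌋)` is non-empty for `ε ≥ -1`, in particular for the
`ε > 0` of Theorem 24 and for B1. [folklore] -/
theorem ofLanguage_headLang_mem_promiseLift_FORMULAXORae {ε : ℝ} (hε : -1 ≤ ε) :
    PromiseProblem.ofLanguage headLang ∈ promiseLift (FORMULAXORae (powSize (1 + ε))) :=
  ofLanguage_mem_promiseLift_iff.2 (headLang_mem_FORMULAXORae_powSize (by linarith))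

/-- And the almost-formula class of C1 is inhabited. [folklore] -/
theorem ofLanguage_headLang_mem_promiseLift_AlmostFORMULAae_frontierC :
    PromiseProblem.ofLanguage headLang ∈ promiseLift (AlmostFORMULAae (powSize 0.01) (powSize 1.01)) :=
  ofLanguage_mem_promiseLift_iff.2 (headLang_mem_AlmostFORMULAae _ _)

end Literature.Computability.MetaComplexity
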